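import Mathlib

/-!
# BridgeEigenvalue — eigenvalue separation for the Weil projector (TIER4.md Lemma A2.1) (Tier 4, T4-A)

Seat p4 of the blind cell pub-hodge-repro2 (README §6, T4-A). route/TIER4.md Lemma A2.1 chooses
`x = n(a + t) ∈ O′` (`a` a primitive element of `𝐅`, `t ∈ ℕ`) such that the eigenvalue `σ(x)⁴` of
`[x]^*` on the Weil eigenline `H^{(4e_σ)}` differs from its eigenvalue `χ_k(x) = ∏_τ τ(x)^{k_τ}` on
every non-Weil Künneth-eigenline `H^{(k)}`, `|k| = 4`, `k ≠ 4e_σ`. Writing `r_τ := τ(a)` (pairwise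
distinct because `a` generates `𝐅`), the inequality `χ_k(x) ≠ σ(x)⁴` reads
`∏_τ (t + r_τ)^{k_τ} ≠ (t + r_σ)⁴`. This file proves, for any finite index set, any pairwise distinct
complex numbers `r` and any degree `d`, that some `t ∈ ℕ` satisfies all these inequalities at once
(`exists_separation`): for `k ≠ d·e_σ` the monic degree-`d` polynomials `∏_τ (X + r_τ)^{k_τ}` and
`(X + r_σ)^d` differ (they disagree at `X = −r_τ` for a `τ ≠ σ` with `k_τ ≥ 1`), so their difference
is a non-zero polynomial; the product of the finitely many non-zero differences is non-zero, hence has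
a non-root among the infinitely many natural numbers. (No explicit bound is needed; Lemma A2.1's
`t ≤ 2250` is the counting version of the same argument.)
-/

namespace Summit.Ventures.HodgeRepro2.BridgeEigenvalue

open Polynomial

variable {ι : Type*} [Fintype ι] [DecidableEq ι]

/-- The difference polynomial `∏_τ (X + r_τ)^{k_τ} − (X + r_σ)^d ∈ ℂ[X]`. -/
noncomputable def sepPoly (r : ι → ℂ) (d : ℕ) (σ : ι) (k : ι → ℕ) : ℂ[X] :=
  (∏ i, (X + C (r i)) ^ k i) - (X + C (r σ)) ^ d

omit [DecidableEq ι] in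
/-- Evaluation of the difference polynomial. -/
theorem eval_sepPoly (r : ι → ℂ) (d : ℕ) (σ : ι) (k : ι → ℕ) (t : ℂ) :
    eval t (sepPoly r d σ k) = (∏ i, (t + r i) ^ k i) - (t + r σ) ^ d := by
  simp [sepPoly, eval_prod]

/-- If `∑ k = d` and `k ≠ d·e_σ`, some `τ ≠ σ` has `k_τ ≥ 1`. -/
theorem exists_ne_of_ne_single {d : ℕ} {σ : ι} {k : ι → ℕ} (hsum : ∑ i, k i = d)
    (hk : k ≠ Pi.single σ d) : ∃ τ, τ ≠ σ ∧ 1 ≤ k τ := by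
  by_contra h
  have h : ∀ τ, τ ≠ σ → k τ = 0 := fun τ hτ => by
    by_contra hne
    exact h ⟨τ, hτ, by omega⟩
  apply hk
  funext i
  by_cases hi : i = σ
  · subst hi
    have : ∑ j, k j = k i := by
      rw [Finset.sum_eq_single i]
      · intro j _ hj
        have := h j hj
        omega
      · intro hi'
        exact absurd (Finset.mem_univ i) hi'
    rw [Pi.single_eq_same, ← hsum, this]
  · rw [Pi.single_eq_of_ne hi]
    have := h i hi
    omega

/-- **The difference polynomial is non-zero** for non-Weil `k` (`∑ k = d`, `k ≠ d·e_σ`): at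
`X = −r_τ` (with `τ ≠ σ`, `k_τ ≥ 1`) the product vanishes while `(−r_τ + r_σ)^d ≠ 0`. -/
theorem sepPoly_ne_zero (r : ι → ℂ) (hr : Function.Injective r) {d : ℕ} (σ : ι) {k : ι → ℕ}
    (hsum : ∑ i, k i = d) (hk : k ≠ Pi.single σ d) : sepPoly r d σ k ≠ 0 := by
  obtain ⟨τ, hτσ, hkτ⟩ := exists_ne_of_ne_single hsum hk
  intro h0
  have h := congrArg (eval (-r τ)) h0
  rw [eval_sepPoly, eval_zero] at h
  have hprod : (∏ i, (-r τ + r i) ^ k i) = 0 := by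
    apply Finset.prod_eq_zero (Finset.mem_univ τ)
    rw [neg_add_cancel, zero_pow]
    omega
  rw [hprod, zero_sub, neg_eq_zero] at h
  have : -r τ + r σ ≠ 0 := by
    intro h'
    apply hτσ
    apply hr
    linear_combination -h'
  exact this (pow_eq_zero_iff (n := d) (by
    -- d ≥ 1 since k τ ≥ 1 contributes to the sum
    have : 1 ≤ ∑ i, k i := le_trans hkτ (Finset.single_le_sum (fun _ _ => Nat.zero_le _)
      (Finset.mem_univ τ))
    omega) |>.1 h)

/-- The finite set of exponent vectors `k` with `∑ k = d` (all entries `≤ d`). -/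
noncomputable def exponentVectors (d : ℕ) : Finset (ι → ℕ) :=
  (Fintype.piFinset fun _ : ι => Finset.range (d + 1)).filter fun k => ∑ i, k i = d

/-- Every `k` with `∑ k = d` lies in `exponentVectors d`. -/
theorem mem_exponentVectors {d : ℕ} {k : ι → ℕ} (hsum : ∑ i, k i = d) :
    k ∈ exponentVectors (ι := ι) d := by
  unfold exponentVectors
  rw [Finset.mem_filter, Fintype.mem_piFinset]
  refine ⟨fun i => ?_, hsum⟩
  rw [Finset.mem_range]
  have := Finset.single_le_sum (fun _ _ => Nat.zero_le _) (Finset.mem_univ i) (f := k)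
  omega

/-- **Eigenvalue separation (TIER4.md Lemma A2.1, existence form).** For pairwise distinct complex
numbers `r_τ` there is `t ∈ ℕ` such that for every `σ` and every non-Weil exponent vector `k`
(`∑ k = d`, `k ≠ d·e_σ`): `∏_τ (t + r_τ)^{k_τ} ≠ (t + r_σ)^d`. With `r_τ = τ(a)` and
`x = n(a + t)`: `χ_k(x) ≠ σ(x)^d`. -/
theorem exists_separation (r : ι → ℂ) (hr : Function.Injective r) (d : ℕ) :
    ∃ t : ℕ, ∀ σ : ι, ∀ k : ι → ℕ, ∑ i, k i = d → k ≠ Pi.single σ d →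
      (∏ i, ((t : ℂ) + r i) ^ k i) ≠ ((t : ℂ) + r σ) ^ d := by
  classical
  -- the product of all non-zero difference polynomials
  set P : ℂ[X] := ∏ σ, ∏ k ∈ (exponentVectors (ι := ι) d).filter (fun k => k ≠ Pi.single σ d),
    sepPoly r d σ k with hP
  have hP0 : P ≠ 0 := by
    rw [hP]
    apply Finset.prod_ne_zero_iff.2
    intro σ _
    apply Finset.prod_ne_zero_iff.2
    intro k hk
    rw [Finset.mem_filter] at hk
    have hsum : ∑ i, k i = d := (Finset.mem_filter.1 hk.1).2
    exact sepPoly_ne_zero r hr σ hsum hk.2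
  -- a natural number that is not a root of P
  have hroot : ∃ t : ℕ, ¬ P.IsRoot (t : ℂ) := by
    by_contra hall
    have hall : ∀ t : ℕ, P.IsRoot (t : ℂ) := fun t => by
      by_contra hne
      exact hall ⟨t, hne⟩
    apply hP0
    apply Polynomial.eq_zero_of_infinite_isRoot
    apply Set.Infinite.mono (s := Set.range (fun t : ℕ => (t : ℂ)))
    · rintro x ⟨t, rfl⟩
      exact hall t
    · exact Set.infinite_range_of_injective Nat.cast_injective
  obtain ⟨t, ht⟩ := hroot
  refine ⟨t, fun σ k hsum hk => ?_⟩
  intro heq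
  apply ht
  rw [IsRoot, hP, eval_prod]
  apply Finset.prod_eq_zero (Finset.mem_univ σ)
  rw [eval_prod]
  refine Finset.prod_eq_zero (i := k) ?_ ?_
  · rw [Finset.mem_filter]
    exact ⟨mem_exponentVectors hsum, hk⟩
  · rw [eval_sepPoly, heq, sub_self]

end Summit.Ventures.HodgeRepro2.BridgeEigenvalue
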